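import Summits.AnomalousDissipation.AnomalousDissipation.Theorems.WazewskiBlockUniformGalerkinTrapSteadyFixedPoint
import Summits.AnomalousDissipation.AnomalousDissipation.Theses.WazewskiBlock
import Literature.Analysis.FluidPDE.CheskidovAssemblyTools
import Literature.Analysis.FunctionSpaces.TorusFourierCalculus

/-!
# Kernel-checked composition of the line `SketchIdeator1` (arm β, frozen faces) for the crux
# `WazewskiBlock.UniformGalerkinTrap` (stmt-AnomalousDissipation-10352)

Definition-FREE support file: the sorry-free, CONDITIONAL composition of the lead's skeleton
`Cruxes/UniformGalerkinTrap/Lines/SketchIdeator1.lean` (a workfile, not importable), stated over landed vocabulary only, so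
that the line's one open registered stub — `stub_steadyLoudAllLevels`, taken here as the hypothesis `hbet` VERBATIM (its
transparent abbreviations unfolded) — and the tree speak about the same statement.

* `frozen_power_identity` — on an equilibrium of `Torus.galerkinFlow ν f N` the exact energy identity freezes to
  `ν‖∇U‖² = (f, U)` (clause block of `IsGalerkinMode.galerkinFlow_clauses` on the constant orbit over `[0,1]`);
* `work_le_sqrt_mul_sqrt` — Cauchy–Schwarz `(f,U) ≤ ‖f‖₂ √(2·kineticEnergy U)`;
* `UniformGalerkinTrap_of_steadyLoudAllLevels` — **the composition**: loud bounded mean-zero steady Galerkin states at every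
  level `N ≥ N₀(ν)` for every `0 < ν ≤ ν₀` (the bet) imply the crux BY NAME, with the AUTOMATIC `N`-uniform enstrophy cap
  `G(ν) := ‖f‖₂√(2E)/ν`: a steady state is an equilibrium (`UniformGalerkinTrap.stub_steadyFixedPoint`, p102267), its constant
  orbit carries the clause block (`IsGalerkinMode.galerkinFlow_clauses`), and on it `νZ = W ≤ ‖f‖₂√(2E)`;
* `line_glue` — the same, curried name through which the lead lands this file `--supports`.

A CONDITIONAL result: it credits the item only when the bet lands (the bet implies the open crux
`MirrorVariety.GalerkinSteadyZerothLaw`, stmt-2986: `Theorems/WazewskiBlockUniformGalerkinTrapBetDiagnostics.lean`).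
References: the card `Cruxes/UniformGalerkinTrap/Ideas/frozen-faces-coherent-structures.md`; Temam 1979 Ch. II (1.29);
Robinson–Rodrigo–Sadowski 2016 Thm 4.4 Steps 1–2.
-/

noncomputable section

-- `Summit.<Summit>.<Problem>` is the tree's mandated summit-side namespace (CONVENTIONS §2); deliberate duplicate.
set_option linter.dupNamespace false

open MeasureTheory Set Filter
open scoped ENNReal NNReal InnerProductSpace

namespace Summit.AnomalousDissipation.AnomalousDissipation.Theorems.UniformGalerkinTrap

open Literature.Analysis.FunctionSpaces Literature.Analysis.FunctionSpaces.Torus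
open Literature.Analysis.FluidPDE

/-- **Frozen power identity.** On an equilibrium `U` of the Galerkin semiflow of order `N` (`U` a Galerkin mode,
`Torus.galerkinFlow ν f N t U = U` for `t ≥ 0`, `ν ≥ 0`, smooth `f`), the dissipation is finite and `ν‖∇U‖² = (f, U)`:
the exact energy identity of `IsGalerkinMode.galerkinFlow_clauses` on the constant orbit over `[0, 1]`. [folklore] -/
theorem frozen_power_identity {N : ℕ} {f U : UnitAddTorus (Fin 3) → EuclideanSpace ℝ (Fin 3)} {ν : ℝ}
    (hf : IsSmooth f) (hν : 0 ≤ ν) (hU : IsGalerkinMode N U)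
    (hfix : ∀ t : ℝ, 0 ≤ t → Torus.galerkinFlow ν f N t U = U) :
    eGradNormSq U ≠ ⊤ ∧ ν * (eGradNormSq U).toReal = ∫ x, inner ℝ (f x) (U x) := by
  have hf2 : MemLp f 2 volume := hf.memLp 2
  obtain ⟨-, -, -, -, henergy⟩ := hU.galerkinFlow_clauses (ν := ν) hν hf2
  have htop : eGradNormSq U ≠ ⊤ := (eGradNormSq_lt_top hU.isSmooth).ne
  refine ⟨htop, ?_⟩
  have h := henergy 0 1 le_rfl zero_le_one
  rw [hfix 1 zero_le_one, hfix 0 le_rfl] at h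
  have hlin : (∫⁻ τ in Ioo (0:ℝ) 1, eGradNormSq (Torus.galerkinFlow ν f N τ U)) = eGradNormSq U := by
    rw [setLIntegral_congr_fun measurableSet_Ioo (fun τ hτ => by rw [hfix τ hτ.1.le]),
      setLIntegral_const, Real.volume_Ioo]
    simp
  have hint : (∫ τ in (0:ℝ)..1, ∫ x, inner ℝ (f x) (Torus.galerkinFlow ν f N τ U x)) =
      ∫ x, inner ℝ (f x) (U x) := by
    rw [intervalIntegral.integral_congr (g := fun _ => ∫ x, inner ℝ (f x) (U x)) (fun τ hτ => ?_)]
    · simp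
    · have hτ0 : 0 ≤ τ := by
        rw [Set.uIcc_of_le zero_le_one] at hτ
        exact hτ.1
      simp only [hfix τ hτ0]
  rw [hlin, hint] at h
  linarith

/-- **Cauchy–Schwarz for the work**: `(f,U) ≤ ‖f‖₂ · √(2·kineticEnergy U)` for smooth `f, U`. [folklore] -/
theorem work_le_sqrt_mul_sqrt {f U : UnitAddTorus (Fin 3) → EuclideanSpace ℝ (Fin 3)} (hf : IsSmooth f)
    (hU : IsSmooth U) :
    ∫ x, inner ℝ (f x) (U x) ≤ Real.sqrt (∫ x, ‖f x‖ ^ 2) * Real.sqrt (2 * kineticEnergy U) := by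
  have h := abs_integral_inner_le_sqrt_mul_sqrt (μ := volume) (hf.memLp 2) (hU.memLp 2)
  have h2 : 2 * kineticEnergy U = ∫ x, ‖U x‖ ^ 2 := by
    unfold kineticEnergy; ring
  rw [h2]
  exact (le_abs_self _).trans h

/-- **Composition of the line `SketchIdeator1` (arm β, frozen faces; kernel-checked glue).**  Hypothesis `hbet` = the
registered stub `stub_steadyLoudAllLevels` of the lead's skeleton, verbatim: a mean-zero trigonometric-polynomial force `f`,
constants `E, ε₀, ν₀ > 0`, and for every `0 < ν ≤ ν₀` an order `N₀` such that every level `N ≥ N₀` carries a mean-zero Galerkin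
mode `U` of order `N` solving the tested steady Galerkin equations with `kineticEnergy U ≤ E` and `(f, U) ≥ ε₀`.  Conclusion:
the route decl `WazewskiBlock.UniformGalerkinTrap`, with the cap `G(ν) := (‖f‖₂√(2E)/ν).toNNReal` and the same `N₀(ν)`: the
constant curve `t ↦ U` is the orbit of the equilibrium `U` (`stub_steadyFixedPoint`), carries the four clauses
(`IsGalerkinMode.galerkinFlow_clauses`), and its enstrophy is frozen at `(f,U)/ν ≤ ‖f‖₂√(2E)/ν` (`frozen_power_identity`,
`work_le_sqrt_mul_sqrt`).  A CONDITIONAL result: it credits the item only when the bet lands. [folklore] -/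
theorem UniformGalerkinTrap_of_steadyLoudAllLevels
    (hbet : ∃ (m : ℕ) (f : UnitAddTorus (Fin 3) → EuclideanSpace ℝ (Fin 3)),
      ((IsSmooth f ∧ IsDivFree f ∧ ∀ k : Fin 3 → ℤ, ((m : ℕ) : ℝ) ^ 2 < freqNormSq k →
        UnitAddTorus.mFourierCoeff (EuclideanSpace.complexify ∘ f) k = 0) ∧ HasZeroMean f) ∧
      ∃ (E ε₀ ν₀ : ℝ), 0 < ε₀ ∧ 0 < ν₀ ∧
        ∀ ν : ℝ, 0 < ν → ν ≤ ν₀ → ∃ N₀ : ℕ, ∀ N : ℕ, N₀ ≤ N →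
          ∃ U : UnitAddTorus (Fin 3) → EuclideanSpace ℝ (Fin 3), IsGalerkinMode N U ∧ HasZeroMean U ∧
            (∀ a : UnitAddTorus (Fin 3) → EuclideanSpace ℝ (Fin 3), IsGalerkinMode N a →
              ∫ x, (⟪U x, convect U a x⟫_ℝ + ν * ⟪U x, laplacian a x⟫_ℝ + ⟪f x, a x⟫_ℝ) = 0) ∧
            kineticEnergy U ≤ E ∧ ε₀ ≤ ∫ x, inner ℝ (f x) (U x)) :
    Summit.AnomalousDissipation.AnomalousDissipation.Theses.WazewskiBlock.UniformGalerkinTrap := by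
  obtain ⟨m, f, ⟨hf, hmean⟩, E, ε₀, ν₀, hε₀, hν₀, h⟩ := hbet
  refine ⟨m, f, hf, hmean, E, ε₀, ν₀, hε₀, hν₀, fun ν hν hνle => ?_⟩
  obtain ⟨N₀, hN⟩ := h ν hν hνle
  refine ⟨(Real.sqrt (∫ x, ‖f x‖ ^ 2) * Real.sqrt (2 * E) / ν).toNNReal, N₀, fun N hN₀ => ?_⟩
  obtain ⟨U, hU, -, hsteady, hKE, hW⟩ := hN N hN₀
  have hfs : IsSmooth f := hf.1
  have hf2 : MemLp f 2 volume := hfs.memLp 2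
  -- the steady state is an equilibrium of the semiflow (landed stub, p102267)
  have hfix : ∀ t : ℝ, 0 ≤ t → Torus.galerkinFlow ν f N t U = U :=
    fun t ht => stub_steadyFixedPoint hf2 hU hsteady ht
  -- the constant orbit carries the clause block
  obtain ⟨-, hcont, hslice, htest, henergy⟩ := hU.galerkinFlow_clauses (ν := ν) hν.le hf2
  refine ⟨fun t => Torus.galerkinFlow ν f N t U, ⟨hcont, fun t ht => hslice t ht,
    fun b hb s t hs hst => htest b hb s t hs hst, henergy⟩, fun t ht => ?_⟩
  dsimp only
  rw [hfix t ht]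
  refine ⟨hKE, hW, ?_⟩
  -- frozen enstrophy: `Z = W/ν ≤ ‖f‖₂ √(2E) / ν`
  obtain ⟨htop, hpow⟩ := frozen_power_identity hfs hν.le hU hfix
  have hwork := work_le_sqrt_mul_sqrt hfs hU.isSmooth
  have hE : 2 * kineticEnergy U ≤ 2 * E := by linarith
  have h1 : (eGradNormSq U).toReal ≤ Real.sqrt (∫ x, ‖f x‖ ^ 2) * Real.sqrt (2 * E) / ν := by
    rw [le_div_iff₀ hν]
    calc (eGradNormSq U).toReal * ν = ν * (eGradNormSq U).toReal := mul_comm _ _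
      _ = ∫ x, inner ℝ (f x) (U x) := hpow
      _ ≤ Real.sqrt (∫ x, ‖f x‖ ^ 2) * Real.sqrt (2 * kineticEnergy U) := hwork
      _ ≤ Real.sqrt (∫ x, ‖f x‖ ^ 2) * Real.sqrt (2 * E) := by gcongr
  show eGradNormSq U ≤ ENNReal.ofReal (Real.sqrt (∫ x, ‖f x‖ ^ 2) * Real.sqrt (2 * E) / ν)
  rw [← ENNReal.ofReal_toReal htop]
  exact ENNReal.ofReal_le_ofReal h1

/-- **Line glue, curried form**: the registered bet of the line `SketchIdeator1` implies the crux
`WazewskiBlock.UniformGalerkinTrap` (by `UniformGalerkinTrap_of_steadyLoudAllLevels`). [folklore] -/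
theorem line_glue : (∃ (m : ℕ) (f : UnitAddTorus (Fin 3) → EuclideanSpace ℝ (Fin 3)), ((IsSmooth f ∧ IsDivFree f ∧ ∀ k : Fin 3 → ℤ, ((m : ℕ) : ℝ) ^ 2 < freqNormSq k → UnitAddTorus.mFourierCoeff (EuclideanSpace.complexify ∘ f) k = 0) ∧ HasZeroMean f) ∧ ∃ (E ε₀ ν₀ : ℝ), 0 < ε₀ ∧ 0 < ν₀ ∧ ∀ ν : ℝ, 0 < ν → ν ≤ ν₀ → ∃ N₀ : ℕ, ∀ N : ℕ, N₀ ≤ N → ∃ U : UnitAddTorus (Fin 3) → EuclideanSpace ℝ (Fin 3), IsGalerkinMode N U ∧ HasZeroMean U ∧ (∀ a : UnitAddTorus (Fin 3) → EuclideanSpace ℝ (Fin 3), IsGalerkinMode N a → ∫ x, (⟪U x, convect U a x⟫_ℝ + ν * ⟪U x, laplacian a x⟫_ℝ + ⟪f x, a x⟫_ℝ) = 0) ∧ kineticEnergy U ≤ E ∧ ε₀ ≤ ∫ x, inner ℝ (f x) (U x)) → Summit.AnomalousDissipation.AnomalousDissipation.Theses.WazewskiBlock.UniformGalerkinTrap 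:=
  fun hbet => UniformGalerkinTrap_of_steadyLoudAllLevels hbet

end Summit.AnomalousDissipation.AnomalousDissipation.Theorems.UniformGalerkinTrap

end
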